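import Summits.QuantumFields.YangMills.Theorems.TwistedTraceScaling.Negative.ActionWindowCoreDefect
import Summits.QuantumFields.YangMills.Theorems.LuscherReductionTwistedTraceScalingToronOrbit
import Summits.QuantumFields.YangMills.Theorems.LuscherReductionTwistedTraceScalingSlowShadow
import Summits.QuantumFields.YangMills.Theorems.LuscherReductionTwistedTraceScalingBOCentralEventually
import HarnessLib

/-!
# R54 (crux `TwistedTraceScaling`, stmt-QuantumFields-20203), part 1 of 2: the COMPLETE (C4) window ledger of `core_transfer_defect_le` on schedule B —
# `hb_small` holds for the defect exponent iff the output radius, the input radius and the action ceiling have exponents `s > 1/6`, `p > 1/6`, `q > 1/3`;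
# `BOBricks.hcore` forces `p ≤ 1/5` (binding, affordable) and excludes the landed record's input window `powScale (1/3) β`

Standing disprover `ym-cdisprove-20203-1` (gen 43), sequel to R50/R50T/R52 (input-radius slot, `…Negative.SmearingWindow{Cost,Band,Schedule}`), R53/R53R/R53S
(action-ceiling slot, `…Negative.ActionWindow{Schedule,Record,CoreDefect}`).  Lane A's step (C4) (HANDOFF-g18 «NEXT SEAT»: `core_transfer_defect_le → hOD_of_defect →
BOBricks.hb_small`) runs `…BOCoreDefectPointwise.core_transfer_defect_le` with exponent, VERBATIM,
`η = coreEta L β δ (δ+δu) T R Γ σ + coreEps1 L β δ T R + coreEps2 L β δ T R σ` — `δ` the quaternion radius of the slow point `u'` (`hu'`), `δu` that of the test window (`hφw`), `σ` the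
one-site action ceiling of both — and `…BOAssemblyBricks.BOBricks` demands `hcore : ∀ᶠ β, {orbitDist < 13(L³β)^{-1/5}} ⊆ 𝒰_β` of the slow window in which `φ` lives.
* §1 `window_radius_of_core`: a quaternion window `{∀k, ‖q(u_k) − 1‖ ≤ δu}` containing an `orbitDist`-core of radius `ρ ≤ 1` has `δu ≥ ρ/4` (witness `(diagSU2 (ρ/2), 1, 1)`).
* §2 `input_radius_of_hcore`: hence `hcore` + `𝒰_β ⊆` input window force `δu(β) ≥ (13/4)(L³β)^{-1/5}` eventually.
* §3 `exponent_normal_form`, `exponent_le_radius`: `η ≤ ρ·(1614|E|βT² + 216βΓ + 145005300N₃βR² + 2193291N_PβT²)` once `δ, δ+δu, T ≤ ρ ≤ 1`, `σ ≤ ρ²`.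
* §4 `coreDefect_floor_of_hcore` (`η ≥ 192·2025·|E|L²ℓ⁴·(13/4)(L³β)^{-1/5}` eventually: a floor of exponent `1/5`, binding for every (C4) on `BOBricks`) and `hcore_floor_hb_small`
  (that floor squared is `≤ a·λ_b` eventually for every `a > 0`: AFFORDABLE, `1/5 > 1/6`).
* §5 THE LEDGER on schedule B (`T_B = 45Lβ^{-1/2}ℓ² + β^{-1}`, `r_f`, `Γ_B = β^{-1}N_S`): `not_hb_small_of_powScale_floor` (generic endpoint lemma, `p ≤ 1/6`),
  ★ `not_hb_small_of_output_radius` (NEW slot: `δ ≥ D·β^{-s}`, `s ≤ 1/6` ⇒ dead), ★ `not_hb_small_of_input_radius` (`p ≤ 1/6`, endpoint now included), the `σ`-slot being R53S;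
  and conversely (part 2, `…Negative.CoreWindowBand`, namespace `R54B`) ★★★ `windows_hb_small`: `δ ≤ Dβ^{-s}`, `δu ≤ Aβ^{-p}`, `σ ≤ Sβ^{-q}` with `s, p > 1/6`, `q > 1/3` ⇒ `η = O(ℓ⁶β^{-min(s,p,q/2,1/2)})` and `∀ a > 0, ∀ᶠ β, η² ≤ a·λ_b(L³β)`
  (`windows_exponent_le` is the deterministic bound); ★★ `hcore_windows_hb_small` (the forced input radius `13(L³β)^{-1/5}` is admissible); ★★ `record_inputWindow_not_core`
  (the landed record's input window `powScale (1/3) β`, p703178, eventually misses a core configuration — it cannot serve as `BOBricks.𝒰`).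
* §6 (part 2) `defectConst_le_three`, `defectConst_hb_small`: `ε = max (1 − e^{−η}(1−η_c)) (e^{η}(1+η_c) − 1) ≤ 3(η + η_c)` on `[0,1]²`, so `hb_small` for `η` and `η_c` gives it for `ε`.
READING: every lane-A theorem quoted is TRUE as landed (incl. `…BOCentralRates{,Two,Three,Four}`, all deviations of exponent `≥ 1/2` or super-polynomial); this file prices the
three (C4) windows before (C4) is written: the admissible region is the open box `s, p > 1/6`, `q > 1/3`, `hcore` pins `p ∈ (1/6, 1/5]`, and the record's `σ = β^{-1/3}`,
`δu = β^{-1/3}` must BOTH move (`σ` up in decay is impossible — `q > 1/3` means a SMALLER ceiling, e.g. `β^{-1/2}`; `δu` to a LARGER window `≍ β^{-1/5}`).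
HONEST FRAMING: stub of a child of the CONDITIONAL reduction route R2b1; nothing here refutes `TwistedTraceScaling`; (C4), (C5), (B-ST), C4-CORE remain OPEN; not infinite
volume, not a mass gap, not Clay.
-/

set_option autoImplicit false

noncomputable section

open Real Filter Topology
open Literature.MathematicalPhysics.QuantumFieldTheory
open Literature.MathematicalPhysics.QuantumLattice
open Summit.QuantumFields.YangMills.Theorems.FemtoTransferGap
open Summit.QuantumFields.YangMills.Theorems.FemtoTransferGap.TwoLattice
open Summit.QuantumFields.YangMills.Theorems.FemtoTransferGap.TwoLattice.Toron (abelianCfg orbitDist_abelianCfg_le)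
open Summit.QuantumFields.YangMills.Theorems.FemtoTransferGap.TwoLattice.Cov (stepActionErr stepActionErr_nonneg)
open Summit.QuantumFields.YangMills.Theorems.FemtoTransferGap.TwoLattice.ConstTube (norm_su2Quat_sub_sq coreEta coreEps1 coreEps2 btLog one_le_btLog
  schedT_le eventually_btLog_eq tendsto_btLog_atTop mul_powScale_one mul_powScale_half_sq tendsto_powScale_mul_btLog_pow powScale_mul_powScale tendsto_powScale'
  coreEps1_nonneg coreEps2_nonneg coreEta_nonneg)
open Summit.QuantumFields.YangMills.Theorems.TwistedTraceScaling.Negative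

namespace Summit.QuantumFields.YangMills.Theorems.TwistedTraceScaling.Negative.R54

/-! ## §1 A quaternion window containing an `orbitDist`-core has comparable radius -/

/-- `‖q(diag(e^{it},e^{-it})) − 1‖² = 2(1 − cos t)`. [folklore] -/
theorem norm_su2Quat_diagSU2_sub_one_sq (t : ℝ) : ‖su2Quat (diagSU2 t) - 1‖ ^ 2 = 2 * (1 - Real.cos t) := by
  have h := norm_su2Quat_sub_sq (diagSU2 t) 1
  rw [FemtoTransferGap.su2Quat_one, OneMemClass.coe_one, frobNorm_diagSU2_sub_one_sq] at h
  linarith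

/-- For `|t| ≤ 1`: `t²/2 ≤ ‖q(diagSU2 t) − 1‖²` (`cos t ≤ 1 − t²/2 + (5/96)t⁴`). [folklore] -/
theorem sq_half_le_norm_su2Quat_diagSU2_sub_one_sq {t : ℝ} (ht : |t| ≤ 1) : t ^ 2 / 2 ≤ ‖su2Quat (diagSU2 t) - 1‖ ^ 2 := by
  rw [norm_su2Quat_diagSU2_sub_one_sq]
  have hc := Real.cos_bound ht
  have h4 : |t| ^ 4 ≤ t ^ 2 := by
    have h2 : |t| ^ 2 ≤ 1 := by nlinarith [abs_nonneg t]
    calc |t| ^ 4 = |t| ^ 2 * |t| ^ 2 := by ring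
      _ ≤ |t| ^ 2 * 1 := mul_le_mul_of_nonneg_left h2 (sq_nonneg _)
      _ = t ^ 2 := by rw [mul_one, sq_abs]
  have := (abs_le.mp hc).2
  nlinarith

/-- The one-link diagonal configuration `u_t = (diagSU2 t, 1, 1)` on the one-site lattice has `orbitDist u_t ≤ √2·|t|`. [folklore] -/
theorem orbitDist_oneLink_le (t : ℝ) : orbitDist (abelianCfg 1 ![t, 0, 0]) ≤ Real.sqrt 2 * |t| := by
  have h := orbitDist_abelianCfg_le (L := 1) ![t, 0, 0]
  simpa [Fin.sum_univ_three] using h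

/-- Its first link is `diagSU2 t`. [folklore] -/
theorem oneLink_apply_zero (t : ℝ) : abelianCfg 1 ![t, 0, 0] (0, 0) = diagSU2 t := rfl

/-- ★ **A quaternion-radius window that contains an `orbitDist`-core of radius `ρ ≤ 1` has radius `≥ ρ/4`**: if every one-site configuration `u` with
`orbitDist u < ρ` satisfies `‖q(u_k) − 1‖ ≤ δu` for all three links, then `ρ/4 ≤ δu` (witness `u_{ρ/2} = (diagSU2 (ρ/2), 1, 1)`:
`orbitDist ≤ √2ρ/2 < ρ`, `‖q − 1‖² ≥ ρ²/8`). [folklore] -/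
theorem window_radius_of_core {ρ δu : ℝ} (hρ0 : 0 < ρ) (hρ1 : ρ ≤ 1)
    (h : ∀ u : GaugeConfig 3 1 FemtoTransferGap.SU2, orbitDist u < ρ → ∀ k : Fin 3, ‖su2Quat (u (0, k)) - 1‖ ≤ δu) : ρ / 4 ≤ δu := by
  have hs2 : Real.sqrt 2 < 2 := by
    rw [show (2 : ℝ) = Real.sqrt (2 ^ 2) from (Real.sqrt_sq (by norm_num)).symm]
    exact Real.sqrt_lt_sqrt (by norm_num) (by norm_num)
  have hod : orbitDist (abelianCfg 1 ![ρ / 2, 0, 0]) < ρ := by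
    refine lt_of_le_of_lt (orbitDist_oneLink_le (ρ / 2)) ?_
    rw [abs_of_pos (by positivity)]
    nlinarith
  have hk := h _ hod 0
  rw [oneLink_apply_zero] at hk
  have hsq := sq_half_le_norm_su2Quat_diagSU2_sub_one_sq (t := ρ / 2) (by rw [abs_of_pos (by positivity)]; linarith)
  have hn0 : 0 ≤ ‖su2Quat (diagSU2 (ρ / 2)) - 1‖ := norm_nonneg _
  have hδu0 : 0 ≤ δu := hn0.trans hk
  nlinarith [mul_le_mul hk hk hn0 hδu0]

variable {L : ℕ} [NeZero L]

/-! ## §2 The core radius `13·(L³β)^{-1/5}` of `BOBricks.hcore` -/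

omit [NeZero L] in
/-- `13·(L³β)^{-1/5} = 13·(L³)^{-1/5}·powScale (1/5) β` for `β ≥ 1`. [folklore] -/
theorem coreRadius_eq {β : ℝ} (hβ : 1 ≤ β) :
    13 * (((L : ℝ)) ^ 3 * β) ^ (-(1 / 5 : ℝ)) = 13 * ((L : ℝ) ^ 3) ^ (-(1 / 5 : ℝ)) * powScale (1 / 5) β := by
  rw [Real.mul_rpow (by positivity) (by linarith), powScale_eq hβ]; ring

/-- `13·(L³β)^{-1/5} ≤ 13·powScale (1/5) β` for `β ≥ 1` (`L ≥ 1`). [folklore] -/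
theorem coreRadius_le {β : ℝ} (hβ : 1 ≤ β) : 13 * (((L : ℝ)) ^ 3 * β) ^ (-(1 / 5 : ℝ)) ≤ 13 * powScale (1 / 5) β := by
  rw [coreRadius_eq hβ]
  have hL : (1 : ℝ) ≤ (L : ℝ) ^ 3 := one_le_pow₀ (by exact_mod_cast Nat.one_le_iff_ne_zero.mpr (NeZero.ne L))
  have h1 : ((L : ℝ) ^ 3) ^ (-(1 / 5 : ℝ)) ≤ 1 := Real.rpow_le_one_of_one_le_of_nonpos hL (by norm_num)
  have h0 : 0 < powScale (1 / 5) β := powScale_pos _ _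
  nlinarith

/-- `0 < 13·(L³β)^{-1/5}` for `β > 0`. [folklore] -/
theorem coreRadius_pos {β : ℝ} (hβ : 0 < β) : 0 < 13 * (((L : ℝ)) ^ 3 * β) ^ (-(1 / 5 : ℝ)) := by
  have hL : (0 : ℝ) < (L : ℝ) ^ 3 := pow_pos (by exact_mod_cast Nat.pos_of_ne_zero (NeZero.ne L)) 3
  exact mul_pos (by norm_num) (Real.rpow_pos_of_pos (mul_pos hL hβ) _)

/-- `13·(L³β)^{-1/5} → 0`. [folklore] -/
theorem tendsto_coreRadius : Tendsto (fun β : ℝ => 13 * (((L : ℝ)) ^ 3 * β) ^ (-(1 / 5 : ℝ))) atTop (𝓝 0) := by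
  have hL : (0 : ℝ) < (L : ℝ) ^ 3 := pow_pos (by exact_mod_cast Nat.pos_of_ne_zero (NeZero.ne L)) 3
  have h := ((tendsto_rpow_neg_atTop (by norm_num : (0 : ℝ) < 1 / 5)).comp (tendsto_id.const_mul_atTop hL)).const_mul 13
  simpa using h

/-- ★★ **`hcore` FORCES THE INPUT RADIUS**: if the slow window `𝒰_β` contains the core `{orbitDist < 13(L³β)^{-1/5}}` (`BOBricks.hcore`) and sits inside the quaternion window of radius
`δu(β)` of `…BOCoreDefectPointwise.core_transfer_defect_le` (`hφw` for `φ` supported in `𝒰_β`), then `(13/4)·(L³β)^{-1/5} ≤ δu(β)` eventually. [folklore] -/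
theorem input_radius_of_hcore {𝒰 : ℝ → Set (GaugeConfig 3 1 FemtoTransferGap.SU2)} {δu : ℝ → ℝ}
    (hcore : ∀ᶠ β : ℝ in atTop, ∀ u : GaugeConfig 3 1 FemtoTransferGap.SU2, orbitDist u < 13 * (((L : ℝ)) ^ 3 * β) ^ (-(1 / 5 : ℝ)) → u ∈ 𝒰 β)
    (hwin : ∀ᶠ β : ℝ in atTop, ∀ u ∈ 𝒰 β, ∀ k : Fin 3, ‖su2Quat (u (0, k)) - 1‖ ≤ δu β) :
    ∀ᶠ β : ℝ in atTop, 13 / 4 * (((L : ℝ)) ^ 3 * β) ^ (-(1 / 5 : ℝ)) ≤ δu β := by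
  have h1 : ∀ᶠ β : ℝ in atTop, 13 * (((L : ℝ)) ^ 3 * β) ^ (-(1 / 5 : ℝ)) ≤ 1 := (tendsto_coreRadius (L := L)).eventually (eventually_le_nhds one_pos)
  filter_upwards [hcore, hwin, h1, eventually_gt_atTop 0] with β hc hw h1' hβ
  have := window_radius_of_core (coreRadius_pos (L := L) hβ) h1' (fun u hu k => hw u (hc u hu) k)
  linarith

/-! ## §3 ★ The radius bound: the exponent is linear in the dominating radius -/

/-- **Normal form of the (C4) defect exponent** `η = coreEta L β δ α T R Γ σ + coreEps1 L β δ T R + coreEps2 L β δ T R σ` as a sum of `β`-weighted monomials. [folklore] -/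
theorem exponent_normal_form (β δ α T R Γ σ : ℝ) :
    coreEta L β δ α T R Γ σ + coreEps1 L β δ T R + coreEps2 L β δ T R σ =
      (Fintype.card (Edge 3 L) : ℝ) * (β * T ^ 2) * (558 * α ^ 2 + 192 * α + 288 * δ + 576 * δ ^ 2) + 216 * (β * Γ) * (α * δ) +
        (Fintype.card (Plaquette 3 L × Fin 3) : ℝ) * (β * R ^ 2) * (50 * σ + 5040 * α + 160 * δ + 145000000 * δ ^ 2) +
        Real.sqrt (Fintype.card (Plaquette 3 L × Fin 3) : ℝ) ^ 2 * (β * R ^ 2) * (50 * σ) +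
        (Fintype.card (Plaquette 3 L) : ℝ) * (β * T ^ 2) * (2 * (1728 * Real.sqrt σ) + 1728 * Real.sqrt 0 + 3 * (29376 * T) + 3 * (700569 * T ^ 2)) := by
  unfold coreEta coreEps1 coreEps2 stepActionErr; ring

/-- ★ **RADIUS BOUND**: if all window data are dominated by one radius `ρ ≤ 1` — `0 ≤ δ ≤ ρ`, `0 ≤ α ≤ ρ`, `0 ≤ σ ≤ ρ²`, `0 ≤ T ≤ ρ` — then
`η ≤ ρ·(1614·|E|·βT² + 216·βΓ + 145005300·N₃·βR² + 2193291·N_P·βT²)` (`β, Γ ≥ 0`). [folklore] -/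
theorem exponent_le_radius {β δ α T R Γ σ ρ : ℝ} (hβ : 0 ≤ β) (hΓ : 0 ≤ Γ) (hρ1 : ρ ≤ 1) (hδ0 : 0 ≤ δ) (hδ : δ ≤ ρ) (hα0 : 0 ≤ α) (hα : α ≤ ρ)
    (hσ : σ ≤ ρ ^ 2) (hT0 : 0 ≤ T) (hT : T ≤ ρ) :
    coreEta L β δ α T R Γ σ + coreEps1 L β δ T R + coreEps2 L β δ T R σ ≤
      ρ * (1614 * (Fintype.card (Edge 3 L) : ℝ) * (β * T ^ 2) + 216 * (β * Γ) + 145005300 * (Fintype.card (Plaquette 3 L × Fin 3) : ℝ) * (β * R ^ 2) +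
        2193291 * (Fintype.card (Plaquette 3 L) : ℝ) * (β * T ^ 2)) := by
  rw [exponent_normal_form, Real.sqrt_zero, Real.sq_sqrt (Nat.cast_nonneg _)]
  have hρ0 : 0 ≤ ρ := hδ0.trans hδ
  have hE : (0 : ℝ) ≤ (Fintype.card (Edge 3 L) : ℝ) := Nat.cast_nonneg _
  have hN : (0 : ℝ) ≤ (Fintype.card (Plaquette 3 L × Fin 3) : ℝ) := Nat.cast_nonneg _
  have hP : (0 : ℝ) ≤ (Fintype.card (Plaquette 3 L) : ℝ) := Nat.cast_nonneg _
  have hX : 0 ≤ β * T ^ 2 := by positivity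
  have hY : 0 ≤ β * R ^ 2 := by positivity
  have hG : 0 ≤ β * Γ := by positivity
  have hρρ : ρ ^ 2 ≤ ρ := by nlinarith
  have hα2 : α ^ 2 ≤ ρ := (pow_le_pow_left₀ hα0 hα 2).trans hρρ
  have hδ2 : δ ^ 2 ≤ ρ := (pow_le_pow_left₀ hδ0 hδ 2).trans hρρ
  have hT2 : T ^ 2 ≤ ρ := (pow_le_pow_left₀ hT0 hT 2).trans hρρ
  have hσ1 : σ ≤ ρ := hσ.trans hρρ
  have hαδ : α * δ ≤ ρ := (mul_le_mul hα hδ hδ0 hρ0).trans (by nlinarith)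
  have hsσ : Real.sqrt σ ≤ ρ := by
    rw [← Real.sqrt_sq hρ0]; exact Real.sqrt_le_sqrt hσ
  -- the four brackets
  have b1 : 558 * α ^ 2 + 192 * α + 288 * δ + 576 * δ ^ 2 ≤ 1614 * ρ := by linarith
  have b2 : 50 * σ + 5040 * α + 160 * δ + 145000000 * δ ^ 2 ≤ 145005250 * ρ := by linarith
  have b3 : 50 * σ ≤ 50 * ρ := by linarith
  have b4 : 2 * (1728 * Real.sqrt σ) + 1728 * 0 + 3 * (29376 * T) + 3 * (700569 * T ^ 2) ≤ 2193291 * ρ := by linarith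
  have c1 := mul_le_mul_of_nonneg_left b1 (mul_nonneg hE hX)
  have c2 := mul_le_mul_of_nonneg_left hαδ (mul_nonneg (by norm_num : (0:ℝ) ≤ 216) hG)
  have c3 := mul_le_mul_of_nonneg_left b2 (mul_nonneg hN hY)
  have c4 := mul_le_mul_of_nonneg_left b3 (mul_nonneg hN hY)
  have c5 := mul_le_mul_of_nonneg_left b4 (mul_nonneg hP hX)
  nlinarith [c1, c2, c3, c4, c5]


/-! ## §4 The `hcore` floor of the (C4) exponent on schedule B — binding, but affordable -/

/-- `192·|E|·βT²·α ≤ η` for nonnegative data (all other monomials of the normal form are `≥ 0`). [folklore] -/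
theorem alphaTerm_le_exponent {β δ α T R Γ σ : ℝ} (hβ : 0 ≤ β) (hδ : 0 ≤ δ) (hα : 0 ≤ α) (hT : 0 ≤ T) (hΓ : 0 ≤ Γ) (hσ : 0 ≤ σ) :
    192 * (Fintype.card (Edge 3 L) : ℝ) * (β * T ^ 2) * α ≤ coreEta L β δ α T R Γ σ + coreEps1 L β δ T R + coreEps2 L β δ T R σ := by
  rw [exponent_normal_form, Real.sqrt_zero]
  have hE : (0 : ℝ) ≤ (Fintype.card (Edge 3 L) : ℝ) := Nat.cast_nonneg _
  have hN : (0 : ℝ) ≤ (Fintype.card (Plaquette 3 L × Fin 3) : ℝ) := Nat.cast_nonneg _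
  have hP : (0 : ℝ) ≤ (Fintype.card (Plaquette 3 L) : ℝ) := Nat.cast_nonneg _
  have hX : 0 ≤ β * T ^ 2 := by positivity
  have hY : 0 ≤ β * R ^ 2 := by positivity
  have hs : 0 ≤ Real.sqrt σ := Real.sqrt_nonneg _
  have h1 : 0 ≤ (Fintype.card (Edge 3 L) : ℝ) * (β * T ^ 2) * (558 * α ^ 2 + 288 * δ + 576 * δ ^ 2) := by positivity
  have h2 : 0 ≤ 216 * (β * Γ) * (α * δ) := by positivity
  have h3 : 0 ≤ (Fintype.card (Plaquette 3 L × Fin 3) : ℝ) * (β * R ^ 2) * (50 * σ + 5040 * α + 160 * δ + 145000000 * δ ^ 2) := by positivity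
  have h4 : 0 ≤ Real.sqrt (Fintype.card (Plaquette 3 L × Fin 3) : ℝ) ^ 2 * (β * R ^ 2) * (50 * σ) := by positivity
  have h5 : 0 ≤ (Fintype.card (Plaquette 3 L) : ℝ) * (β * T ^ 2) * (2 * (1728 * Real.sqrt σ) + 1728 * 0 + 3 * (29376 * T) + 3 * (700569 * T ^ 2)) := by
    have : 0 ≤ 2 * (1728 * Real.sqrt σ) + 1728 * 0 + 3 * (29376 * T) + 3 * (700569 * T ^ 2) := by positivity
    positivity
  nlinarith

/-- ★★ **THE `hcore` FLOOR**: on schedule B (`βT_B² ≥ 2025L²ℓ⁴`, R53), for every (C4) use of `core_transfer_defect_le` whose input window contains `BOBricks.𝒰_β ⊇ core`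
(`δu ≥ (13/4)(L³β)^{-1/5}`, §2) and all nonnegative `δ, Γ, σ`, any `R`:
`192·2025·|E|·L²·ℓ⁴·(13/4)(L³β)^{-1/5} ≤ η(β)` eventually — a floor of exponent `1/5`, INSIDE the admissible band (`1/5 > 1/6`), cf. `hcore_floor_hb_small`. [folklore] -/
theorem coreDefect_floor_of_hcore {𝒰 : ℝ → Set (GaugeConfig 3 1 FemtoTransferGap.SU2)} {δ δu R Γ σ : ℝ → ℝ}
    (hδ : ∀ β, 0 ≤ δ β) (hΓ : ∀ β, 0 ≤ Γ β) (hσ : ∀ β, 0 ≤ σ β)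
    (hcore : ∀ᶠ β : ℝ in atTop, ∀ u : GaugeConfig 3 1 FemtoTransferGap.SU2, orbitDist u < 13 * (((L : ℝ)) ^ 3 * β) ^ (-(1 / 5 : ℝ)) → u ∈ 𝒰 β)
    (hwin : ∀ᶠ β : ℝ in atTop, ∀ u ∈ 𝒰 β, ∀ k : Fin 3, ‖su2Quat (u (0, k)) - 1‖ ≤ δu β) :
    ∀ᶠ β : ℝ in atTop,
      192 * 2025 * (Fintype.card (Edge 3 L) : ℝ) * (L : ℝ) ^ 2 * btLog β ^ 4 * (13 / 4 * (((L : ℝ)) ^ 3 * β) ^ (-(1 / 5 : ℝ))) ≤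
        coreEta L β (δ β) (δ β + δu β) (9 * (L : ℝ) * (5 * (powScale (1 / 2) β * btLog β ^ 2)) + powScale 1 β) (R β) (Γ β) (σ β) +
          coreEps1 L β (δ β) (9 * (L : ℝ) * (5 * (powScale (1 / 2) β * btLog β ^ 2)) + powScale 1 β) (R β) +
          coreEps2 L β (δ β) (9 * (L : ℝ) * (5 * (powScale (1 / 2) β * btLog β ^ 2)) + powScale 1 β) (R β) (σ β) := by
  filter_upwards [input_radius_of_hcore hcore hwin, eventually_ge_atTop (1 : ℝ)] with β hdu hβ
  have hβ0 : 0 ≤ β := by linarith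
  have hr0 : 0 ≤ 13 / 4 * (((L : ℝ)) ^ 3 * β) ^ (-(1 / 5 : ℝ)) := by have := coreRadius_pos (L := L) (by linarith : 0 < β); linarith
  have hdu0 : 0 ≤ δu β := hr0.trans hdu
  have hα0 : 0 ≤ δ β + δu β := add_nonneg (hδ β) hdu0
  have hT0 := R52.schedT_nonneg (L := L) β
  have hX := R53.logpow_le_beta_schedT_sq (L := L) hβ
  have hE : (0 : ℝ) ≤ (Fintype.card (Edge 3 L) : ℝ) := Nat.cast_nonneg _
  have hmain := alphaTerm_le_exponent (L := L) (R := R β) hβ0 (hδ β) hα0 hT0 (hΓ β) (hσ β)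
  have hα : 13 / 4 * (((L : ℝ)) ^ 3 * β) ^ (-(1 / 5 : ℝ)) ≤ δ β + δu β := by linarith [hδ β]
  calc 192 * 2025 * (Fintype.card (Edge 3 L) : ℝ) * (L : ℝ) ^ 2 * btLog β ^ 4 * (13 / 4 * (((L : ℝ)) ^ 3 * β) ^ (-(1 / 5 : ℝ)))
      = 192 * (Fintype.card (Edge 3 L) : ℝ) * (2025 * (L : ℝ) ^ 2 * btLog β ^ 4) * (13 / 4 * (((L : ℝ)) ^ 3 * β) ^ (-(1 / 5 : ℝ))) := by ring
    _ ≤ 192 * (Fintype.card (Edge 3 L) : ℝ) * (β * (9 * (L : ℝ) * (5 * (powScale (1 / 2) β * btLog β ^ 2)) + powScale 1 β) ^ 2) * (δ β + δu β) :=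
        mul_le_mul (mul_le_mul_of_nonneg_left hX (by positivity)) hα hr0 (by positivity)
    _ ≤ _ := hmain

/-- ★ … **BUT THIS FLOOR IS AFFORDABLE**: `∀ a > 0, ∀ᶠ β, (192·2025·|E|·L²·ℓ⁴·(13/4)(L³β)^{-1/5})² ≤ a·λ_b(L³β)` (`(L³β)^{-1/5} ≤ β^{-1/5}`, `1/5 > 1/6`, R50T). So `hcore` alone
does not sink (C4): the obstruction of R53/R53R/R53S is exactly the action ceiling `σ`. [folklore] -/
theorem hcore_floor_hb_small :
    ∀ a : ℝ, 0 < a → ∀ᶠ β : ℝ in atTop,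
      (192 * 2025 * (Fintype.card (Edge 3 L) : ℝ) * (L : ℝ) ^ 2 * btLog β ^ 4 * (13 / 4 * (((L : ℝ)) ^ 3 * β) ^ (-(1 / 5 : ℝ)))) ^ 2 ≤
        a * bareLambda ((L : ℝ) ^ 3 * β) := by
  intro a ha
  have hA : 0 ≤ 192 * 2025 * (Fintype.card (Edge 3 L) : ℝ) * (L : ℝ) ^ 2 * (13 / 4) := by positivity
  obtain ⟨β0, h⟩ := R50T.polylog_window_affordable (L := L) (s := 1 / 5) (A := 192 * 2025 * (Fintype.card (Edge 3 L) : ℝ) * (L : ℝ) ^ 2 * (13 / 4))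
    (ε := 16 * a) (θ := 1) 4 (by norm_num) hA (by linarith) one_pos
  filter_upwards [eventually_ge_atTop β0, eventually_ge_atTop (1 : ℝ), eventually_btLog_eq] with β hβ0 hβ1 hℓ
  obtain ⟨b, hb, hb2⟩ := h β hβ0
  have hr := coreRadius_le (L := L) hβ1
  have hr0 : 0 ≤ 13 / 4 * (((L : ℝ)) ^ 3 * β) ^ (-(1 / 5 : ℝ)) := by have := coreRadius_pos (L := L) (by linarith : 0 < β); linarith
  have hfl0 : 0 ≤ 192 * 2025 * (Fintype.card (Edge 3 L) : ℝ) * (L : ℝ) ^ 2 * btLog β ^ 4 * (13 / 4 * (((L : ℝ)) ^ 3 * β) ^ (-(1 / 5 : ℝ))) := by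
    have := one_le_btLog β; positivity
  have hle : 192 * 2025 * (Fintype.card (Edge 3 L) : ℝ) * (L : ℝ) ^ 2 * btLog β ^ 4 * (13 / 4 * (((L : ℝ)) ^ 3 * β) ^ (-(1 / 5 : ℝ))) ≤ b := by
    refine le_trans ?_ hb
    rw [← hℓ]
    have hℓ4 : 0 ≤ btLog β ^ 4 := by have := one_le_btLog β; positivity
    have : 13 / 4 * (((L : ℝ)) ^ 3 * β) ^ (-(1 / 5 : ℝ)) ≤ 13 / 4 * powScale (1 / 5) β := by linarith
    calc _ ≤ 192 * 2025 * (Fintype.card (Edge 3 L) : ℝ) * (L : ℝ) ^ 2 * btLog β ^ 4 * (13 / 4 * powScale (1 / 5) β) :=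
          mul_le_mul_of_nonneg_left this (by positivity)
      _ = _ := by ring
  calc _ ≤ b ^ 2 := pow_le_pow_left₀ hfl0 hle 2
    _ ≤ 16 * a * 1 * bareLambda ((L : ℝ) ^ 3 * β) / 16 := hb2
    _ = a * bareLambda ((L : ℝ) ^ 3 * β) := by ring

/-! ## §5 ★★★ The complete (C4) window ledger on schedule B: `hb_small` holds iff `s, p > 1/6` and `q > 1/3` -/

/-- **Generic endpoint lemma**: a rate with a floor `c·powScale p β ≤ b(β)` (`c > 0`, `p ≤ 1/6`) is not `hb_small` (`λ_b(L³β) = (2/L³)^{1/3}β^{-1/3}`). [folklore] -/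
theorem not_hb_small_of_powScale_floor {b : ℝ → ℝ} {c p : ℝ} (hc : 0 < c) (hp : p ≤ 1 / 6) (hfl : ∀ᶠ β : ℝ in atTop, c * powScale p β ≤ b β) :
    ¬ ∀ a : ℝ, 0 < a → ∀ᶠ β : ℝ in atTop, b β ^ 2 ≤ a * bareLambda ((L : ℝ) ^ 3 * β) := by
  intro H
  have hL : (0 : ℝ) < (L : ℝ) ^ 3 := pow_pos (by exact_mod_cast Nat.pos_of_ne_zero (NeZero.ne L)) 3
  set M : ℝ := (2 / (L : ℝ) ^ 3) ^ ((1 : ℝ) / 3) with hM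
  have hM0 : 0 < M := Real.rpow_pos_of_pos (by positivity) _
  have ha : 0 < c ^ 2 / (2 * M) := by positivity
  obtain ⟨β, hb, hH, hβ1⟩ := (hfl.and ((H _ ha).and (eventually_ge_atTop (1 : ℝ)))).exists
  have hps0 : 0 < powScale p β := powScale_pos _ _
  have hb0 : 0 ≤ b β := le_trans (by positivity) hb
  have h1 : c ^ 2 * powScale (1 / 3) β ≤ b β ^ 2 := by
    calc c ^ 2 * powScale (1 / 3) β ≤ c ^ 2 * powScale (2 * p) β := mul_le_mul_of_nonneg_left (powScale_le_powScale (by linarith) β) (sq_nonneg _)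
      _ = (c * powScale p β) ^ 2 := by rw [mul_pow, R21.powScale_sq]
      _ ≤ b β ^ 2 := pow_le_pow_left₀ (by positivity) hb 2
  have h2 : b β ^ 2 ≤ c ^ 2 / 2 * powScale (1 / 3) β := by
    calc b β ^ 2 ≤ c ^ 2 / (2 * M) * bareLambda ((L : ℝ) ^ 3 * β) := hH
      _ = c ^ 2 / (2 * M) * (M * powScale (1 / 3) β) := by rw [R53.bareLambda_cube_eq_powScale (L := L) hβ1]
      _ = c ^ 2 / 2 * powScale (1 / 3) β := by field_simp
  have h3 : 0 < c ^ 2 * powScale (1 / 3) β := mul_pos (pow_pos hc 2) (powScale_pos _ _)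
  linarith

/-- ★ **OUTPUT-RADIUS SLOT** (`δ`, the slow radius of `u'`; new): on schedule B a floor `D·powScale s β ≤ δ(β)` with `D > 0`, `s ≤ 1/6` sinks `hb_small` for every rate `b ≥ c·η`
(`η ≥ 288·|E|·βT_B²·δ ≥ 288·2025·|E|·L²·D·β^{-s}`; all other data nonnegative). [folklore] -/
theorem not_hb_small_of_output_radius {δ δu R Γ σ b : ℝ → ℝ} {c D s : ℝ} (hc : 0 < c) (hD : 0 < D) (hs : s ≤ 1 / 6)
    (hδu : ∀ β, 0 ≤ δu β) (hΓ : ∀ β, 0 ≤ Γ β) (hσ : ∀ β, 0 ≤ σ β) (hδfl : ∀ᶠ β : ℝ in atTop, D * powScale s β ≤ δ β)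
    (hfloor : ∀ᶠ β : ℝ in atTop,
      c * (coreEta L β (δ β) (δ β + δu β) (9 * (L : ℝ) * (5 * (powScale (1 / 2) β * btLog β ^ 2)) + powScale 1 β) (R β) (Γ β) (σ β) +
          coreEps1 L β (δ β) (9 * (L : ℝ) * (5 * (powScale (1 / 2) β * btLog β ^ 2)) + powScale 1 β) (R β) +
          coreEps2 L β (δ β) (9 * (L : ℝ) * (5 * (powScale (1 / 2) β * btLog β ^ 2)) + powScale 1 β) (R β) (σ β)) ≤ b β) :
    ¬ ∀ a : ℝ, 0 < a → ∀ᶠ β : ℝ in atTop, b β ^ 2 ≤ a * bareLambda ((L : ℝ) ^ 3 * β) := by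
  have hE : (0 : ℝ) < Fintype.card (Edge 3 L) := by exact_mod_cast Fintype.card_pos
  have hL1 : (1 : ℝ) ≤ (L : ℝ) := by exact_mod_cast Nat.one_le_iff_ne_zero.mpr (NeZero.ne L)
  refine not_hb_small_of_powScale_floor (L := L) (c := c * (288 * (Fintype.card (Edge 3 L) : ℝ) * 2025 * D)) (p := s) (by positivity) hs ?_
  filter_upwards [hfloor, hδfl, eventually_ge_atTop (1 : ℝ)] with β hb hδ hβ
  have hβ0 : 0 ≤ β := by linarith
  have hδ0 : 0 ≤ δ β := le_trans (by positivity [powScale_pos s β]) hδ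
  have hT0 := R52.schedT_nonneg (L := L) β
  have hX := R53.logpow_le_beta_schedT_sq (L := L) hβ
  have hℓ4 : 1 ≤ btLog β ^ 4 := one_le_pow₀ (one_le_btLog β)
  -- `288|E|·βT²·δ ≤ η` from the normal form
  have hkey : 288 * (Fintype.card (Edge 3 L) : ℝ) * (β * (9 * (L : ℝ) * (5 * (powScale (1 / 2) β * btLog β ^ 2)) + powScale 1 β) ^ 2) * δ β ≤
      coreEta L β (δ β) (δ β + δu β) (9 * (L : ℝ) * (5 * (powScale (1 / 2) β * btLog β ^ 2)) + powScale 1 β) (R β) (Γ β) (σ β) +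
        coreEps1 L β (δ β) (9 * (L : ℝ) * (5 * (powScale (1 / 2) β * btLog β ^ 2)) + powScale 1 β) (R β) +
        coreEps2 L β (δ β) (9 * (L : ℝ) * (5 * (powScale (1 / 2) β * btLog β ^ 2)) + powScale 1 β) (R β) (σ β) := by
    rw [exponent_normal_form, Real.sqrt_zero]
    set T := 9 * (L : ℝ) * (5 * (powScale (1 / 2) β * btLog β ^ 2)) + powScale 1 β
    have hα0 : 0 ≤ δ β + δu β := add_nonneg hδ0 (hδu β)
    have hN : (0 : ℝ) ≤ (Fintype.card (Plaquette 3 L × Fin 3) : ℝ) := Nat.cast_nonneg _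
    have hP : (0 : ℝ) ≤ (Fintype.card (Plaquette 3 L) : ℝ) := Nat.cast_nonneg _
    have hXn : 0 ≤ β * T ^ 2 := by positivity
    have hY : 0 ≤ β * R β ^ 2 := by positivity
    have hs0 : 0 ≤ Real.sqrt (σ β) := Real.sqrt_nonneg _
    have hΓ0 := hΓ β
    have hσ0 := hσ β
    have h1 : 0 ≤ (Fintype.card (Edge 3 L) : ℝ) * (β * T ^ 2) * (558 * (δ β + δu β) ^ 2 + 192 * (δ β + δu β) + 576 * δ β ^ 2) := by positivity
    have h2 : 0 ≤ 216 * (β * Γ β) * ((δ β + δu β) * δ β) := by positivity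
    have h3 : 0 ≤ (Fintype.card (Plaquette 3 L × Fin 3) : ℝ) * (β * R β ^ 2) * (50 * σ β + 5040 * (δ β + δu β) + 160 * δ β + 145000000 * δ β ^ 2) := by
      positivity
    have h4 : 0 ≤ Real.sqrt (Fintype.card (Plaquette 3 L × Fin 3) : ℝ) ^ 2 * (β * R β ^ 2) * (50 * σ β) := by positivity
    have h5 : 0 ≤ (Fintype.card (Plaquette 3 L) : ℝ) * (β * T ^ 2) * (2 * (1728 * Real.sqrt (σ β)) + 1728 * 0 + 3 * (29376 * T) + 3 * (700569 * T ^ 2)) := by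
      have : 0 ≤ 2 * (1728 * Real.sqrt (σ β)) + 1728 * 0 + 3 * (29376 * T) + 3 * (700569 * T ^ 2) := by positivity
      positivity
    nlinarith
  have hfl : 288 * (Fintype.card (Edge 3 L) : ℝ) * 2025 * D * powScale s β ≤
      288 * (Fintype.card (Edge 3 L) : ℝ) * (β * (9 * (L : ℝ) * (5 * (powScale (1 / 2) β * btLog β ^ 2)) + powScale 1 β) ^ 2) * δ β := by
    have h2025 : (2025 : ℝ) ≤ β * (9 * (L : ℝ) * (5 * (powScale (1 / 2) β * btLog β ^ 2)) + powScale 1 β) ^ 2 := by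
      have hL2 : (1 : ℝ) ≤ (L : ℝ) ^ 2 := one_le_pow₀ hL1
      nlinarith [mul_le_mul hL2 hℓ4 (by norm_num) (by positivity)]
    have hps : 0 ≤ D * powScale s β := by positivity [powScale_pos s β]
    calc 288 * (Fintype.card (Edge 3 L) : ℝ) * 2025 * D * powScale s β = 288 * (Fintype.card (Edge 3 L) : ℝ) * 2025 * (D * powScale s β) := by ring
      _ ≤ 288 * (Fintype.card (Edge 3 L) : ℝ) * (β * (9 * (L : ℝ) * (5 * (powScale (1 / 2) β * btLog β ^ 2)) + powScale 1 β) ^ 2) * δ β :=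
          mul_le_mul (mul_le_mul_of_nonneg_left h2025 (by positivity)) hδ hps (by positivity)
  calc c * (288 * (Fintype.card (Edge 3 L) : ℝ) * 2025 * D) * powScale s β = c * (288 * (Fintype.card (Edge 3 L) : ℝ) * 2025 * D * powScale s β) := by ring
    _ ≤ _ := by nlinarith [mul_le_mul_of_nonneg_left (hfl.trans hkey) hc.le]

/-- ★ **INPUT-RADIUS SLOT, ENDPOINT INCLUDED** (`δu`; R50/R52 had `p < 1/6`): a floor `A·powScale p β ≤ δu(β)`, `A > 0`, `p ≤ 1/6`, sinks `hb_small` for every `b ≥ c·η` on schedule B. [folklore] -/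
theorem not_hb_small_of_input_radius {δ δu R Γ σ b : ℝ → ℝ} {c A p : ℝ} (hc : 0 < c) (hA : 0 < A) (hp : p ≤ 1 / 6)
    (hδ : ∀ β, 0 ≤ δ β) (hΓ : ∀ β, 0 ≤ Γ β) (hσ : ∀ β, 0 ≤ σ β) (hδufl : ∀ᶠ β : ℝ in atTop, A * powScale p β ≤ δu β)
    (hfloor : ∀ᶠ β : ℝ in atTop,
      c * (coreEta L β (δ β) (δ β + δu β) (9 * (L : ℝ) * (5 * (powScale (1 / 2) β * btLog β ^ 2)) + powScale 1 β) (R β) (Γ β) (σ β) +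
          coreEps1 L β (δ β) (9 * (L : ℝ) * (5 * (powScale (1 / 2) β * btLog β ^ 2)) + powScale 1 β) (R β) +
          coreEps2 L β (δ β) (9 * (L : ℝ) * (5 * (powScale (1 / 2) β * btLog β ^ 2)) + powScale 1 β) (R β) (σ β)) ≤ b β) :
    ¬ ∀ a : ℝ, 0 < a → ∀ᶠ β : ℝ in atTop, b β ^ 2 ≤ a * bareLambda ((L : ℝ) ^ 3 * β) := by
  have hE : (0 : ℝ) < Fintype.card (Edge 3 L) := by exact_mod_cast Fintype.card_pos
  have hL1 : (1 : ℝ) ≤ (L : ℝ) := by exact_mod_cast Nat.one_le_iff_ne_zero.mpr (NeZero.ne L)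
  refine not_hb_small_of_powScale_floor (L := L) (c := c * (192 * (Fintype.card (Edge 3 L) : ℝ) * 2025 * A)) (p := p) (by positivity) hp ?_
  filter_upwards [hfloor, hδufl, eventually_ge_atTop (1 : ℝ)] with β hb hdu hβ
  have hβ0 : 0 ≤ β := by linarith
  have hdu0 : 0 ≤ δu β := le_trans (by positivity [powScale_pos p β]) hdu
  have hα0 : 0 ≤ δ β + δu β := add_nonneg (hδ β) hdu0
  have hT0 := R52.schedT_nonneg (L := L) β
  have hℓ4 : 1 ≤ btLog β ^ 4 := one_le_pow₀ (one_le_btLog β)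
  have hkey := alphaTerm_le_exponent (L := L) (R := R β) hβ0 (hδ β) hα0 hT0 (hΓ β) (hσ β)
  have h2025 : (2025 : ℝ) ≤ β * (9 * (L : ℝ) * (5 * (powScale (1 / 2) β * btLog β ^ 2)) + powScale 1 β) ^ 2 := by
    have hX := R53.logpow_le_beta_schedT_sq (L := L) hβ
    have hL2 : (1 : ℝ) ≤ (L : ℝ) ^ 2 := one_le_pow₀ hL1
    nlinarith [mul_le_mul hL2 hℓ4 (by norm_num) (by positivity)]
  have hps : 0 ≤ A * powScale p β := by positivity [powScale_pos p β]
  have hfl : 192 * (Fintype.card (Edge 3 L) : ℝ) * 2025 * A * powScale p β ≤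
      192 * (Fintype.card (Edge 3 L) : ℝ) * (β * (9 * (L : ℝ) * (5 * (powScale (1 / 2) β * btLog β ^ 2)) + powScale 1 β) ^ 2) * (δ β + δu β) := by
    calc 192 * (Fintype.card (Edge 3 L) : ℝ) * 2025 * A * powScale p β = 192 * (Fintype.card (Edge 3 L) : ℝ) * 2025 * (A * powScale p β) := by ring
      _ ≤ 192 * (Fintype.card (Edge 3 L) : ℝ) * (β * (9 * (L : ℝ) * (5 * (powScale (1 / 2) β * btLog β ^ 2)) + powScale 1 β) ^ 2) * (δ β + δu β) :=
          mul_le_mul (mul_le_mul_of_nonneg_left h2025 (by positivity)) (hdu.trans (by linarith [hδ β])) hps (by positivity)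
  calc c * (192 * (Fintype.card (Edge 3 L) : ℝ) * 2025 * A) * powScale p β = c * (192 * (Fintype.card (Edge 3 L) : ℝ) * 2025 * A * powScale p β) := by ring
    _ ≤ _ := by nlinarith [mul_le_mul_of_nonneg_left (hfl.trans hkey) hc.le]


end Summit.QuantumFields.YangMills.Theorems.TwistedTraceScaling.Negative.R54

end
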